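import Summits.Ventures.GridStability.Models.StructurePreservingDissipation
import Summits.Ventures.GridStability.Lyapunov.StructurePreservingLevelBound

/-!
# GridStability/Models/StructurePreservingInstance — instance kit for structure-preserving data:
# symmetric couplings from an edge list, connectivity from a parent-pointer spanning tree, and
# exact synchronous equilibria from half-angle (tan δ/2) rationals

LADDER-GRIDFUSION rung «G2.b-SP» (lead PARTITION A25, 2026-08-27: first structure-preserving
instance = NE39 with 49 nodes), seat gridfusion-model-2; MODEL-VALIDITY row MV-3 (+ tokens of the
named instance). This file is DATA-INDEPENDENT: it supplies the generic lemmas with which a large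
`StructurePreserving.Params n` literal (model-4's exact data) discharges, by `decide`/`norm_num` on
rationals, the hypotheses of the region-of-attraction theorem of record
(`Lyapunov/StructurePreservingRoa.lean`, lyap-1; bridged in `StructurePreservingPhaseBridge.lean`):
* `symmetrize` — couplings `bᵢⱼ = wᵢⱼ + wⱼᵢ` from ONE-directional edge weights `w` (an edge list):
  symmetric by construction (`symmetrize_symm`), nonnegative / bounded below when the weights are
  (`symmetrize_nonneg`), and `symmetrize_ne_zero_of_pos`;
* `preconnected_of_parent` — a PARENT-POINTER spanning tree (every non-root node adjacent to its
  parent, along which an ℕ-valued `depth` strictly decreases) makes a simple graph preconnected —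
  the form in which a 49-node connectivity witness is checkable by `decide`;
* half-angle equilibria (PARTITION A1/A11 «eq=b» convention carried to n buses): for
  `δᵢ = 2·arctan tᵢ` the printed sine/cosine are the RATIONAL functions `sin δᵢ = 2tᵢ/(1 + tᵢ²)`,
  `cos δᵢ = (1 − tᵢ²)/(1 + tᵢ²)` (the Lyapunov seat's `sin_two_mul_arctan` / `cos_two_mul_arctan`,
  reused), the injections `fᵢ(δ)` are the polynomial `pePoly` in those rationals (`pe_halfAngle`),
  the branch angle is `δᵢ − δⱼ = 2·arctan((tᵢ − tⱼ)/(1 + tᵢtⱼ))` when `tᵢtⱼ > −1`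
  (`two_mul_arctan_sub`), hence the WINDOW datum `|δᵢ − δⱼ| ≤ 2·arctan τ` from the rational test
  `|(tᵢ − tⱼ)/(1 + tᵢtⱼ)| ≤ τ` (`abs_halfAngle_sub_le`), with `2·arctan τ < π/2` iff `τ < 1` (the
  Lyapunov seat's `two_mul_arctan_lt_pi_div_two`, reused);
* indexed edge lists (`edgeWeight`: `m` edges `src e → tgt e` with weight `wt e`): nonnegativity,
  `le_symmetrize_of_ne_zero` (every nonzero coupling `≥ β` from `m` checks `β ≤ wt e`),
  `symmetrize_edgeWeight_ne_zero_of_edge` (tree adjacency off the list), `window_of_edgeChecks`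
  (the window hypothesis on ALL coupled pairs from `m` per-edge rational checks);
* `isSyncEquilibrium_of_P0_eq_pe` — if the injected powers are DEFINED as `P⁰ := f(δ₀)` (the eq=b
  redefinition «P′ := pe(δ₀)», exact), then `Σ P⁰ = 0` (losslessness), the synchronous frequency
  `ω₀ = 0`, `P̄ = P⁰`, and `δ₀` is a synchronous equilibrium — for EVERY damping vector `D`.
Everything is PROVED; no instance data here (model-4 custody); MODELLED column only.
[cite: Padiyar2013, §3.2 eqs (3.2)–(3.5)]; [cite: BergenHill1981].
-/

noncomputable section

open Finset Real Set

namespace Summit.Ventures.GridStability.Models.StructurePreserving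

variable {n : ℕ}

/-! ## Symmetric couplings from one-directional edge weights -/

/-- Couplings from an edge list: `bᵢⱼ = wᵢⱼ + wⱼᵢ`, where `w i j` is the weight recorded for the
directed entry `(i, j)` (zero when the list has no such entry). -/
def symmetrize (w : Fin n → Fin n → ℝ) (i j : Fin n) : ℝ := w i j + w j i

/-- `symmetrize w` is symmetric. -/
theorem symmetrize_symm (w : Fin n → Fin n → ℝ) (i j : Fin n) :
    symmetrize w i j = symmetrize w j i := by
  unfold symmetrize; ring

/-- Nonnegative weights give nonnegative couplings. -/
theorem symmetrize_nonneg {w : Fin n → Fin n → ℝ} (hw : ∀ i j, 0 ≤ w i j) (i j : Fin n) :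
    0 ≤ symmetrize w i j :=
  add_nonneg (hw i j) (hw j i)

/-- With nonnegative weights, a coupling is at least each of its two directed weights. -/
theorem le_symmetrize_left {w : Fin n → Fin n → ℝ} (hw : ∀ i j, 0 ≤ w i j) (i j : Fin n) :
    w i j ≤ symmetrize w i j := by
  unfold symmetrize; linarith [hw j i]

/-- With nonnegative weights, a coupling is at least the reversed directed weight. -/
theorem le_symmetrize_right {w : Fin n → Fin n → ℝ} (hw : ∀ i j, 0 ≤ w i j) (i j : Fin n) :
    w j i ≤ symmetrize w i j := by
  unfold symmetrize; linarith [hw i j]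

/-- With nonnegative weights, a positive directed weight makes the coupling nonzero. -/
theorem symmetrize_ne_zero_of_pos {w : Fin n → Fin n → ℝ} (hw : ∀ i j, 0 ≤ w i j) {i j : Fin n}
    (h : 0 < w i j ∨ 0 < w j i) : symmetrize w i j ≠ 0 := by
  have : 0 < symmetrize w i j := by
    unfold symmetrize
    rcases h with h | h
    · linarith [hw j i]
    · linarith [hw i j]
  exact this.ne'

/-! ## Connectivity from a parent-pointer spanning tree -/

/-- **A parent-pointer spanning tree makes a graph preconnected.** If every node other than `root`
is adjacent to its `parent`, and an `ℕ`-valued `depth` strictly decreases from a node to its parent,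
then every node is reachable from `root`, so the graph is preconnected. (This is the shape in which
a connectivity witness for a 49-node literal is checked by `decide`.) -/
theorem preconnected_of_parent {V : Type*} (G : SimpleGraph V) (root : V) (parent : V → V)
    (depth : V → ℕ) (hadj : ∀ v, v ≠ root → G.Adj (parent v) v)
    (hdepth : ∀ v, v ≠ root → depth (parent v) < depth v) : G.Preconnected := by
  have hreach : ∀ k, ∀ v, depth v ≤ k → G.Reachable root v := by
    intro k
    induction k with
    | zero =>
      intro v hv
      by_cases h : v = root
      · subst h; exact SimpleGraph.Reachable.refl _
      · exact absurd (hdepth v h) (by omega)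
    | succ k ih =>
      intro v hv
      by_cases h : v = root
      · subst h; exact SimpleGraph.Reachable.refl _
      · have hp : G.Reachable root (parent v) := ih (parent v) (by have := hdepth v h; omega)
        exact hp.trans (SimpleGraph.Adj.reachable (hadj v h))
  intro u v
  exact (hreach _ u le_rfl).symm.trans (hreach _ v le_rfl)

/-- The coupling graph of structure-preserving data is preconnected as soon as a parent-pointer
spanning tree with NONZERO couplings along it is exhibited (symmetric `b`). -/
theorem Params.couplingGraph_preconnected_of_parent (p : Params n) (hbs : ∀ i j, p.b i j = p.b j i)
    (root : Fin n) (parent : Fin n → Fin n) (depth : Fin n → ℕ)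
    (hne : ∀ v, v ≠ root → parent v ≠ v)
    (hb : ∀ v, v ≠ root → p.b (parent v) v ≠ 0)
    (hdepth : ∀ v, v ≠ root → depth (parent v) < depth v) : p.couplingGraph.Preconnected := by
  refine preconnected_of_parent p.couplingGraph root parent depth (fun v hv => ?_) hdepth
  exact (p.couplingGraph_adj_of_symm hbs (parent v) v).mpr ⟨hne v hv, hb v hv⟩

/-! ## Half-angle (tan δ/2) equilibria: exact sines, cosines, injections and window data -/

-- `sin(2·arctan t) = 2t/(1 + t²)`, `cos(2·arctan t) = (1 − t²)/(1 + t²)`, `0 ≤ 2·arctan τ`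
-- (τ ≥ 0) and `2·arctan τ < π/2` (τ < 1) are the Lyapunov seat's
-- `Summit.Ventures.GridStability.Lyapunov.StructurePreserving.{sin,cos}_two_mul_arctan`,
-- `two_mul_arctan_nonneg`, `two_mul_arctan_lt_pi_div_two`
-- (`Lyapunov/StructurePreservingLevelBound`), reused here, not restated.

/-- The half-angle angle vector of a tuple of rationals/reals `t`: `δᵢ = 2·arctan tᵢ`. -/
def halfAngle (t : Fin n → ℝ) (i : Fin n) : ℝ := 2 * Real.arctan (t i)

/-- Rational sine of a half-angle point: `sᵢ = 2tᵢ/(1 + tᵢ²)`. -/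
def halfSin (t : Fin n → ℝ) (i : Fin n) : ℝ := 2 * t i / (1 + t i ^ 2)

/-- Rational cosine of a half-angle point: `cᵢ = (1 − tᵢ²)/(1 + tᵢ²)`. -/
def halfCos (t : Fin n → ℝ) (i : Fin n) : ℝ := (1 - t i ^ 2) / (1 + t i ^ 2)

/-- `sin (halfAngle t i) = halfSin t i`. -/
@[simp] theorem sin_halfAngle (t : Fin n → ℝ) (i : Fin n) :
    Real.sin (halfAngle t i) = halfSin t i :=
  Lyapunov.StructurePreserving.sin_two_mul_arctan (t i)

/-- `cos (halfAngle t i) = halfCos t i`. -/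
@[simp] theorem cos_halfAngle (t : Fin n → ℝ) (i : Fin n) :
    Real.cos (halfAngle t i) = halfCos t i :=
  Lyapunov.StructurePreserving.cos_two_mul_arctan (t i)

/-- A half-angle point lies on the unit circle: `sᵢ² + cᵢ² = 1`. -/
theorem halfSin_sq_add_halfCos_sq (t : Fin n → ℝ) (i : Fin n) :
    halfSin t i ^ 2 + halfCos t i ^ 2 = 1 := by
  unfold halfSin halfCos
  have hpos : (0 : ℝ) < 1 + t i ^ 2 := by positivity
  field_simp
  ring

/-- **The injections at a half-angle equilibrium are the polynomial `pePoly` in the rational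
sines/cosines** (exact; no transcendental function left): `fᵢ(δ) = Σⱼ bᵢⱼ (sᵢcⱼ − cᵢsⱼ)`. -/
theorem Params.pe_halfAngle (p : Params n) (t : Fin n → ℝ) :
    p.pe (halfAngle t) = p.pePoly (halfSin t) (halfCos t) := by
  rw [← p.pePoly_sin_cos (halfAngle t)]
  congr 1 <;> funext i <;> simp

/-- Every half-angle lies strictly inside `(−π, π)`. -/
theorem abs_halfAngle_lt_pi (t : Fin n → ℝ) (i : Fin n) : |halfAngle t i| < π := by
  unfold halfAngle
  have h1 := Real.arctan_lt_pi_div_two (t i)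
  have h2 := Real.neg_pi_div_two_lt_arctan (t i)
  rw [abs_lt]; constructor <;> linarith

/-- **Branch angle in half-angle data**: for `tᵢtⱼ > −1`,
`2·arctan tᵢ − 2·arctan tⱼ = 2·arctan((tᵢ − tⱼ)/(1 + tᵢtⱼ))` (`Real.arctan_add` with `y = −tⱼ`). -/
theorem two_mul_arctan_sub {a b : ℝ} (hab : -1 < a * b) :
    2 * Real.arctan a - 2 * Real.arctan b = 2 * Real.arctan ((a - b) / (1 + a * b)) := by
  have h : a * -b < 1 := by nlinarith
  have hadd := Real.arctan_add h
  rw [Real.arctan_neg] at hadd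
  have : (a + -b) / (1 - a * -b) = (a - b) / (1 + a * b) := by ring_nf
  rw [this] at hadd
  linarith

/-- **Window datum from rationals**: if `tᵢtⱼ > −1` and `|(tᵢ − tⱼ)/(1 + tᵢtⱼ)| ≤ τ`, then the
branch angle satisfies `|δᵢ − δⱼ| ≤ 2·arctan τ` (monotonicity and oddness of `arctan`). -/
theorem abs_halfAngle_sub_le {t : Fin n → ℝ} {i j : Fin n} {τ : ℝ} (hij : -1 < t i * t j)
    (hτ : |(t i - t j) / (1 + t i * t j)| ≤ τ) :
    |halfAngle t i - halfAngle t j| ≤ 2 * Real.arctan τ := by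
  unfold halfAngle
  rw [two_mul_arctan_sub hij]
  set q := (t i - t j) / (1 + t i * t j) with hq
  have hle := abs_le.mp hτ
  have h1 : Real.arctan q ≤ Real.arctan τ := Real.arctan_mono hle.2
  have h2 : Real.arctan (-τ) ≤ Real.arctan q := Real.arctan_mono hle.1
  rw [Real.arctan_neg] at h2
  rw [abs_le]; constructor <;> linarith

/-! ## Indexed edge lists: weights, lower bounds, and per-edge checks -/

/-- One-directional weights from an INDEXED edge list (`m` edges with endpoints `src e`, `tgt e`
and weight `wt e`): `w i j = Σ_e [src e = i ∧ tgt e = j]·wt e` (parallel entries add up). -/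
def edgeWeight {m : ℕ} (src tgt : Fin m → Fin n) (wt : Fin m → ℝ) (i j : Fin n) : ℝ :=
  ∑ e, if src e = i ∧ tgt e = j then wt e else 0

variable {m : ℕ} {src tgt : Fin m → Fin n} {wt : Fin m → ℝ}

/-- Nonnegative edge weights give nonnegative one-directional weights. -/
theorem edgeWeight_nonneg (hwt : ∀ e, 0 ≤ wt e) (i j : Fin n) : 0 ≤ edgeWeight src tgt wt i j :=
  Finset.sum_nonneg fun e _ => by split_ifs <;> [exact hwt e; exact le_rfl]

/-- A listed edge contributes at least its weight (nonnegative weights). -/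
theorem le_edgeWeight_of_edge (hwt : ∀ e, 0 ≤ wt e) (e : Fin m) {i j : Fin n} (hs : src e = i)
    (ht : tgt e = j) : wt e ≤ edgeWeight src tgt wt i j := by
  unfold edgeWeight
  have := Finset.single_le_sum (f := fun e' => if src e' = i ∧ tgt e' = j then wt e' else 0)
    (fun e' _ => by
      show (0 : ℝ) ≤ if src e' = i ∧ tgt e' = j then wt e' else 0
      split_ifs <;> [exact hwt e'; exact le_rfl]) (Finset.mem_univ e)
  simpa [hs, ht] using this

/-- If no listed edge runs from `i` to `j`, the one-directional weight vanishes. -/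
theorem edgeWeight_eq_zero {i j : Fin n} (h : ∀ e, ¬(src e = i ∧ tgt e = j)) :
    edgeWeight src tgt wt i j = 0 :=
  Finset.sum_eq_zero fun e _ => by rw [if_neg (h e)]

/-- A nonzero coupling `bᵢⱼ = wᵢⱼ + wⱼᵢ` is witnessed by a listed edge in one of the two
orientations. -/
theorem exists_edge_of_symmetrize_ne_zero {i j : Fin n}
    (hne : symmetrize (edgeWeight src tgt wt) i j ≠ 0) :
    ∃ e, (src e = i ∧ tgt e = j) ∨ (src e = j ∧ tgt e = i) := by
  by_contra h
  have h' : ∀ e, ¬((src e = i ∧ tgt e = j) ∨ (src e = j ∧ tgt e = i)) := fun e he => h ⟨e, he⟩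
  apply hne
  unfold symmetrize
  rw [edgeWeight_eq_zero fun e hij => h' e (Or.inl hij),
    edgeWeight_eq_zero fun e hji => h' e (Or.inr hji), add_zero]

/-- **Uniform lower bound on the couplings of the coupling graph**: if every listed weight is
`≥ β` (and `≥ 0`), every NONZERO coupling is `≥ β` — the hypothesis `β ≤ bᵢⱼ` on the edges of
`couplingGraph` of the region-of-attraction theorem, from `m` rational checks. -/
theorem le_symmetrize_of_ne_zero (hwt : ∀ e, 0 ≤ wt e) {β : ℝ} (hβ : ∀ e, β ≤ wt e) {i j : Fin n}
    (hne : symmetrize (edgeWeight src tgt wt) i j ≠ 0) :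
    β ≤ symmetrize (edgeWeight src tgt wt) i j := by
  obtain ⟨e, h | h⟩ := exists_edge_of_symmetrize_ne_zero hne
  · exact (hβ e).trans ((le_edgeWeight_of_edge hwt e h.1 h.2).trans
      (le_symmetrize_left (edgeWeight_nonneg hwt) i j))
  · exact (hβ e).trans ((le_edgeWeight_of_edge hwt e h.1 h.2).trans
      (le_symmetrize_right (edgeWeight_nonneg hwt) i j))

/-- A listed edge with positive weight is a nonzero coupling (nonnegative weights) — used to read
adjacency of a parent-pointer spanning tree off the edge list. -/
theorem symmetrize_edgeWeight_ne_zero_of_edge (hwt : ∀ e, 0 ≤ wt e) (e : Fin m) (hpos : 0 < wt e)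
    {i j : Fin n} (h : (src e = i ∧ tgt e = j) ∨ (src e = j ∧ tgt e = i)) :
    symmetrize (edgeWeight src tgt wt) i j ≠ 0 := by
  refine symmetrize_ne_zero_of_pos (edgeWeight_nonneg hwt) ?_
  rcases h with h | h
  · exact Or.inl (hpos.trans_le (le_edgeWeight_of_edge hwt e h.1 h.2))
  · exact Or.inr (hpos.trans_le (le_edgeWeight_of_edge hwt e h.1 h.2))

/-- **Per-edge window checks suffice**: if for every LISTED edge the half-angle data satisfy
`t_src·t_tgt > −1` and `|(t_src − t_tgt)/(1 + t_src t_tgt)| ≤ τ`, then every coupled pair of the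
data `b = symmetrize (edgeWeight …)` has branch angle `|δᵢ − δⱼ| ≤ 2·arctan τ` at `δ = halfAngle t`
(the `h0` hypothesis of the region-of-attraction theorem, from `m` rational checks). -/
theorem window_of_edgeChecks {t : Fin n → ℝ} {τ : ℝ}
    (hprod : ∀ e, -1 < t (src e) * t (tgt e))
    (hτ : ∀ e, |(t (src e) - t (tgt e)) / (1 + t (src e) * t (tgt e))| ≤ τ) {i j : Fin n}
    (hne : symmetrize (edgeWeight src tgt wt) i j ≠ 0) :
    |halfAngle t i - halfAngle t j| ≤ 2 * Real.arctan τ := by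
  obtain ⟨e, ⟨hs, ht⟩ | ⟨hs, ht⟩⟩ := exists_edge_of_symmetrize_ne_zero hne
  · subst hs; subst ht
    exact abs_halfAngle_sub_le (hprod e) (hτ e)
  · subst hs; subst ht
    rw [abs_sub_comm]
    exact abs_halfAngle_sub_le (hprod e) (hτ e)

/-! ## The eq=b synchronous equilibrium: powers DEFINED as the injections at `δ₀` -/

/-- **If the injected powers are defined as `P⁰ᵢ := fᵢ(δ₀)`** (the exact «P′ := pe(δ₀)»
redefinition of PARTITION A1/A25) for symmetric couplings, then they sum to zero (lossless network),
so the synchronous frequency deviation is `ω₀ = 0`. -/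
theorem Params.syncFreq_eq_zero_of_P0_eq_pe (p : Params n) (hbs : ∀ i j, p.b i j = p.b j i)
    {δ₀ : Fin n → ℝ} (hP : p.P0 = p.pe δ₀) : p.syncFreq = 0 := by
  unfold syncFreq
  rw [hP, p.sum_pe_eq_zero hbs δ₀, zero_div]

/-- With `P⁰ := f(δ₀)`: the shifted powers equal the injected powers, `P̄ = P⁰`. -/
theorem Params.Pbar_eq_P0_of_P0_eq_pe (p : Params n) (hbs : ∀ i j, p.b i j = p.b j i)
    {δ₀ : Fin n → ℝ} (hP : p.P0 = p.pe δ₀) : p.Pbar = p.P0 := by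
  funext i
  rw [Pbar, p.syncFreq_eq_zero_of_P0_eq_pe hbs hP, mul_zero, sub_zero]

/-- **With `P⁰ := f(δ₀)`, `δ₀` is a synchronous equilibrium** — for every damping vector `D`
(the damping does not enter). -/
theorem Params.isSyncEquilibrium_of_P0_eq_pe (p : Params n) (hbs : ∀ i j, p.b i j = p.b j i)
    {δ₀ : Fin n → ℝ} (hP : p.P0 = p.pe δ₀) : p.IsSyncEquilibrium δ₀ := by
  intro i
  rw [p.Pbar_eq_P0_of_P0_eq_pe hbs hP, hP]

/-- With `P⁰ := f(δ₀)` the shifted data coincide with the data: `p.shifted = p`. -/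
theorem Params.shifted_eq_self_of_P0_eq_pe (p : Params n) (hbs : ∀ i j, p.b i j = p.b j i)
    {δ₀ : Fin n → ℝ} (hP : p.P0 = p.pe δ₀) : p.shifted = p := by
  have h := p.Pbar_eq_P0_of_P0_eq_pe hbs hP
  cases p
  simp only [Params.shifted] at h ⊢
  rw [h]

end Summit.Ventures.GridStability.Models.StructurePreserving

end
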